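import Literature.Geometry.Kaehler.ComplexTorusZuckerJ
import HarnessLib

/-!
# An explicit general `J`-lattice `L₀ ⊂ ℂ²` and the periods of constant `2`-forms over integral bivectors

Companion of `Literature/Geometry/Kaehler/ComplexTorusZuckerJ.lean` (Zucker's `J(z, w) = (iz, -iw)`,
`J`-anti-invariant forms, `ω = dz ∧ dw̄`, the square `J`-lattice) for S. Zucker, *The Hodge
conjecture for cubic fourfolds*, Compositio Math. 34 (1977), Appendix B, `n = 1`. The square
`J`-lattice of that file is the self-product of the square elliptic curve; Zucker's Theorem
(p. 208) concerns a GENERAL `J`-lattice. This file fixes an explicit one and the elementary period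
calculus in which Zucker's Proposition (p. 207) is stated; the Proposition itself is proved for it
in `ComplexTorusZuckerPeriods.lean`.

* **The skew lattice** `L₀ = ℤv₁ ⊕ ℤv₂ ⊕ ℤJv₁ ⊕ ℤJv₂`, `v₁ = (1, 1)`, `v₂ = (√2, √3)` (Zucker
  p. 207: "Choosing a basis for `L` of the form `{v₁, …, v₂ₙ, Jv₁, …, Jv₂ₙ}`"), as the period
  isomorphism `Zucker.skewPeriod : ℝ⁴ ≃ₗ[ℝ] ℂ²`,
  `x ↦ (x₀ + √2x₁ + i(x₂ + √2x₃), x₀ + √3x₁ - i(x₂ + √3x₃))` with explicit inverse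
  (`Zucker.skewInv`, using `√3 - √2 ≠ 0`), its basis vectors (`skewPeriod_single_*`), and the
  `J`-lattice property `Φ ∘ A_ℝ = J ∘ Φ` for the integer matrix `A = Zucker.squareMatrix`
  (`Zucker.skewPeriod_mulVec`, `Zucker.skewPeriodCLE_mulVec`: the hypothesis `hA` of
  `Literature/Barriers/HodgeConjecture/KaehlerCounterexamplesJTorus.lean`). The torus
  `T₀ = ℂ²/L₀ = ComplexTorus Zucker.skewPeriodCLE` is the explicit "general `J`-torus".
* **Constant `2`-forms** `f ∧ g` of two real-linear functionals (`Zucker.wedgeForm`,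
  `(f ∧ g)(u, u') = f(u)g(u') - f(u')g(u)`), the coordinate functionals `dz_a`, `dz̄_a` of `ℂ²`
  and the forms `dz ∧ dw` (`Zucker.dzdw`, the holomorphic `2`-form), `dz ∧ dz̄`, `dw ∧ dw̄`
  (`Zucker.dzdzbar`, `Zucker.dwdwbar`; `(i/2)(dz ∧ dz̄ + dw ∧ dw̄)` is the flat Kähler form).
* **Periods over integral bivectors** (`Zucker.latticePairing Φ θ n = Σ_{j,k} n_{jk} θ(e_j, e_k)`,
  `e_j = Φ(δ_j)`): the value of a constant `2`-form `θ` on the integral `2`-homology class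
  `Σ n_{jk} e_j ∧ e_k ∈ ⋀²L = H₂(E/L; ℤ)` of a torus `E/Φ(ℤ^ι)` (Zucker p. 207: "the periods of
  `ω` over the real sub-tori `{e_I}` generated by any `2n` elements of the lattice basis, for
  these tori provide a basis for the homology of `T`"), its bilinear expansion
  `θ(Φm, Φm') = latticePairing Φ θ (m ⊗ m')` for `m, m' ∈ ℤ^ι`
  (`Zucker.apply_intCast_eq_latticePairing`) and the six-term expansion over `ι = Fin 4`
  (`Zucker.latticePairing_fin_four`).

Design: homology classes of the torus are handled as integer coefficient matrices `n` (only the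
alternation `n_{jk} - n_{kj}` matters), with no appeal to singular homology or to de Rham's
theorem — this is the currency in which both Zucker's Proposition ("an integral `2n`-homology
class dual to a class of type `(n, n)` must annihilate `dz ∧ dw`") and the period/positivity
arguments about analytic curves on `T₀` are naturally stated.

NOT here: Zucker's Proposition for `L₀` and its consequences (`ComplexTorusZuckerPeriods.lean`);
anything about analytic subvarieties of `T₀` (Zucker's Theorem p. 208 proper).

## References

* S. Zucker, Compositio Math. 34 (1977) 199–209, Appendix B, pp. 207–208. [Zucker1977]
* H. Lange, Ch. Birkenhake, *Complex Abelian Varieties* (1992), §1.1 (period matrices, lattices).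
  [LangeBirkenhake1992]
-/

noncomputable section

open scoped ComplexConjugate

namespace Literature.Geometry.Kaehler

namespace Zucker

/-! ### The explicit `J`-lattice `L₀ = ℤv₁ ⊕ ℤv₂ ⊕ ℤJv₁ ⊕ ℤJv₂`, `v₁ = (1, 1)`, `v₂ = (√2, √3)` -/

/-- `√2 < √3`, so `√3 - √2 ≠ 0`. [folklore] -/
theorem sqrt_three_sub_sqrt_two_ne_zero : Real.sqrt 3 - Real.sqrt 2 ≠ 0 :=
  sub_ne_zero.mpr (Real.sqrt_lt_sqrt (by norm_num) (by norm_num)).ne'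

/-- `v₁ = (1, 1) ∈ ℂ²`. [cite: Zucker1977, Appendix B p. 207] -/
def v₁ : Fin 2 → ℂ := ![1, 1]

/-- `v₂ = (√2, √3) ∈ ℂ²`. [cite: Zucker1977, Appendix B p. 207] -/
def v₂ : Fin 2 → ℂ := ![((Real.sqrt 2 : ℝ) : ℂ), ((Real.sqrt 3 : ℝ) : ℂ)]

/-- `(v₁)_z = 1`. [folklore] -/
@[simp] theorem v₁_zero : v₁ 0 = 1 := rfl
/-- `(v₁)_w = 1`. [folklore] -/
@[simp] theorem v₁_one : v₁ 1 = 1 := rfl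
/-- `(v₂)_z = √2`. [folklore] -/
@[simp] theorem v₂_zero : v₂ 0 = ((Real.sqrt 2 : ℝ) : ℂ) := rfl
/-- `(v₂)_w = √3`. [folklore] -/
@[simp] theorem v₂_one : v₂ 1 = ((Real.sqrt 3 : ℝ) : ℂ) := rfl

/-- The real-linear map `x ↦ x₀v₁ + x₁v₂ + x₂Jv₁ + x₃Jv₂` of the skew lattice basis, in
coordinates: `(x₀ + √2x₁ + i(x₂ + √2x₃), x₀ + √3x₁ - i(x₂ + √3x₃))`. [cite: Zucker1977, Appendix B p. 207] -/
def skewFun (x : Fin 4 → ℝ) : Fin 2 → ℂ :=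
  ![((x 0 + x 1 * Real.sqrt 2 : ℝ) : ℂ) + ((x 2 + x 3 * Real.sqrt 2 : ℝ) : ℂ) * Complex.I,
    ((x 0 + x 1 * Real.sqrt 3 : ℝ) : ℂ) - ((x 2 + x 3 * Real.sqrt 3 : ℝ) : ℂ) * Complex.I]

/-- The inverse coordinate map of `skewFun`. [folklore] -/
def skewInv (z : Fin 2 → ℂ) : Fin 4 → ℝ :=
  ![(z 0).re - Real.sqrt 2 * (((z 1).re - (z 0).re) / (Real.sqrt 3 - Real.sqrt 2)),
    ((z 1).re - (z 0).re) / (Real.sqrt 3 - Real.sqrt 2),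
    (z 0).im - Real.sqrt 2 * ((-(z 1).im - (z 0).im) / (Real.sqrt 3 - Real.sqrt 2)),
    (-(z 1).im - (z 0).im) / (Real.sqrt 3 - Real.sqrt 2)]

/-- The `z`-coordinate of `skewFun x`. [folklore] -/
@[simp] theorem skewFun_zero (x : Fin 4 → ℝ) :
    skewFun x 0 = ((x 0 + x 1 * Real.sqrt 2 : ℝ) : ℂ) + ((x 2 + x 3 * Real.sqrt 2 : ℝ) : ℂ) * Complex.I := rfl

/-- The `w`-coordinate of `skewFun x`. [folklore] -/
@[simp] theorem skewFun_one (x : Fin 4 → ℝ) :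
    skewFun x 1 = ((x 0 + x 1 * Real.sqrt 3 : ℝ) : ℂ) - ((x 2 + x 3 * Real.sqrt 3 : ℝ) : ℂ) * Complex.I := rfl

/-- `Re z(skewFun x) = x₀ + √2 x₁`. [folklore] -/
theorem skewFun_zero_re (x : Fin 4 → ℝ) : (skewFun x 0).re = x 0 + x 1 * Real.sqrt 2 := by simp
/-- `Im z(skewFun x) = x₂ + √2 x₃`. [folklore] -/
theorem skewFun_zero_im (x : Fin 4 → ℝ) : (skewFun x 0).im = x 2 + x 3 * Real.sqrt 2 := by simp
/-- `Re w(skewFun x) = x₀ + √3 x₁`. [folklore] -/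
theorem skewFun_one_re (x : Fin 4 → ℝ) : (skewFun x 1).re = x 0 + x 1 * Real.sqrt 3 := by simp
/-- `Im w(skewFun x) = -(x₂ + √3 x₃)`. [folklore] -/
theorem skewFun_one_im (x : Fin 4 → ℝ) : (skewFun x 1).im = -(x 2 + x 3 * Real.sqrt 3) := by simp

/-- Component `0` of `skewInv`. [folklore] -/
@[simp] theorem skewInv_zero (z : Fin 2 → ℂ) :
    skewInv z 0 = (z 0).re - Real.sqrt 2 * (((z 1).re - (z 0).re) / (Real.sqrt 3 - Real.sqrt 2)) := rfl
/-- Component `1` of `skewInv`. [folklore] -/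
@[simp] theorem skewInv_one (z : Fin 2 → ℂ) :
    skewInv z 1 = ((z 1).re - (z 0).re) / (Real.sqrt 3 - Real.sqrt 2) := rfl
/-- Component `2` of `skewInv`. [folklore] -/
@[simp] theorem skewInv_two (z : Fin 2 → ℂ) :
    skewInv z 2 = (z 0).im - Real.sqrt 2 * ((-(z 1).im - (z 0).im) / (Real.sqrt 3 - Real.sqrt 2)) := rfl
/-- Component `3` of `skewInv`. [folklore] -/
@[simp] theorem skewInv_three (z : Fin 2 → ℂ) :
    skewInv z 3 = (-(z 1).im - (z 0).im) / (Real.sqrt 3 - Real.sqrt 2) := rfl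

/-- `skewInv` is a left inverse of `skewFun`. [folklore] -/
theorem skewInv_skewFun (x : Fin 4 → ℝ) : skewInv (skewFun x) = x := by
  have hd := sqrt_three_sub_sqrt_two_ne_zero
  funext j
  fin_cases j
  · simp only [Fin.zero_eta, skewInv_zero, skewFun_zero_re, skewFun_one_re]
    field_simp
    ring
  · simp only [Fin.mk_one, skewInv_one, skewFun_zero_re, skewFun_one_re]
    field_simp
    ring
  · simp only [Fin.reduceFinMk, skewInv_two, skewFun_zero_im, skewFun_one_im]
    field_simp
    ring
  · simp only [Fin.reduceFinMk, skewInv_three, skewFun_zero_im, skewFun_one_im]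
    field_simp
    ring

/-- `skewInv` is a right inverse of `skewFun`. [folklore] -/
theorem skewFun_skewInv (z : Fin 2 → ℂ) : skewFun (skewInv z) = z := by
  have hd := sqrt_three_sub_sqrt_two_ne_zero
  have e0 : skewInv z 0 + skewInv z 1 * Real.sqrt 2 = (z 0).re := by
    simp only [skewInv_zero, skewInv_one]; ring
  have e1 : skewInv z 0 + skewInv z 1 * Real.sqrt 3 = (z 1).re := by
    simp only [skewInv_zero, skewInv_one]; field_simp; ring
  have e2 : skewInv z 2 + skewInv z 3 * Real.sqrt 2 = (z 0).im := by
    simp only [skewInv_two, skewInv_three]; ring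
  have e3 : skewInv z 2 + skewInv z 3 * Real.sqrt 3 = -(z 1).im := by
    simp only [skewInv_two, skewInv_three]; field_simp; ring
  funext j
  fin_cases j
  · simp only [Fin.zero_eta, skewFun_zero, e0, e2]
    exact Complex.re_add_im (z 0)
  · simp only [Fin.mk_one, skewFun_one, e1, e3]
    rw [Complex.ofReal_neg, neg_mul, sub_neg_eq_add]
    exact Complex.re_add_im (z 1)

/-- **The skew period isomorphism** `ℝ⁴ ≃ ℂ²` of the `J`-lattice with basis `v₁, v₂, Jv₁, Jv₂`,
`v₁ = (1, 1)`, `v₂ = (√2, √3)` (Zucker p. 207: "Choosing a basis for `L` of the form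
`{v₁, …, v₂ₙ, Jv₁, …, Jv₂ₙ}`", `n = 1`):
`x ↦ x₀v₁ + x₁v₂ + x₂Jv₁ + x₃Jv₂ = (x₀ + √2x₁ + i(x₂ + √2x₃), x₀ + √3x₁ - i(x₂ + √3x₃))`.
[cite: Zucker1977, Appendix B p. 207] -/
def skewPeriod : (Fin 4 → ℝ) ≃ₗ[ℝ] (Fin 2 → ℂ) where
  toFun := skewFun
  map_add' x y := by
    funext j; fin_cases j <;> (simp [skewFun]; ring)
  map_smul' r x := by
    funext j; fin_cases j <;> (simp [skewFun, Complex.real_smul]; ring)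
  invFun := skewInv
  left_inv := skewInv_skewFun
  right_inv := skewFun_skewInv

/-- Unfolding of `skewPeriod`. [cite: Zucker1977, Appendix B p. 207] -/
@[simp] theorem skewPeriod_apply (x : Fin 4 → ℝ) : skewPeriod x = skewFun x := rfl

/-- Unfolding of `skewPeriod.symm`. [folklore] -/
@[simp] theorem skewPeriod_symm_apply (z : Fin 2 → ℂ) : skewPeriod.symm z = skewInv z := rfl

/-- The first basis vector of the lattice is `v₁`. [cite: Zucker1977, Appendix B p. 207] -/
@[simp] theorem skewPeriod_single_zero : skewPeriod (Pi.single 0 1) = v₁ := by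
  funext j; fin_cases j <;> simp [skewFun, v₁]

/-- The second basis vector of the lattice is `v₂`. [cite: Zucker1977, Appendix B p. 207] -/
@[simp] theorem skewPeriod_single_one : skewPeriod (Pi.single 1 1) = v₂ := by
  funext j; fin_cases j <;> simp [skewFun, v₂]

/-- The third basis vector of the lattice is `Jv₁ = (i, -i)`. [cite: Zucker1977, Appendix B p. 207] -/
@[simp] theorem skewPeriod_single_two : skewPeriod (Pi.single 2 1) = J v₁ := by
  funext j; fin_cases j <;> simp [skewFun, v₁]

/-- The fourth basis vector of the lattice is `Jv₂ = (i√2, -i√3)`. [cite: Zucker1977, Appendix B p. 207] -/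
@[simp] theorem skewPeriod_single_three : skewPeriod (Pi.single 3 1) = J v₂ := by
  funext j; fin_cases j <;> (simp [skewFun, v₂]; ring)

/-- **`L₀` is a `J`-lattice**: the skew period isomorphism intertwines the integer matrix
`squareMatrix` (`v₁ ↦ Jv₁ ↦ -v₁`, `v₂ ↦ Jv₂ ↦ -v₂`) with `J`, i.e. `JL₀ = L₀`.
[cite: Zucker1977, Appendix B p. 207] -/
theorem skewPeriod_mulVec (x : Fin 4 → ℝ) :
    skewPeriod ((squareMatrix.map (Int.cast : ℤ → ℝ)).mulVec x) = J (skewPeriod x) := by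
  funext j
  fin_cases j
  · apply Complex.ext
    · simp [skewFun, squareMatrix, Matrix.mulVec, dotProduct, Fin.sum_univ_four]
      ring
    · simp [skewFun, squareMatrix, Matrix.mulVec, dotProduct, Fin.sum_univ_four]
  · apply Complex.ext
    · simp [skewFun, squareMatrix, Matrix.mulVec, dotProduct, Fin.sum_univ_four]
      ring
    · simp [skewFun, squareMatrix, Matrix.mulVec, dotProduct, Fin.sum_univ_four]

/-- The skew period isomorphism as a continuous linear equivalence (the currency of
`ComplexTorus`). [cite: Zucker1977, Appendix B p. 207] -/
abbrev skewPeriodCLE : (Fin 4 → ℝ) ≃L[ℝ] (Fin 2 → ℂ) := skewPeriod.toContinuousLinearEquiv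

/-- Unfolding of `skewPeriodCLE`. [folklore] -/
@[simp] theorem skewPeriodCLE_apply (x : Fin 4 → ℝ) : skewPeriodCLE x = skewPeriod x := rfl

/-- The `J`-lattice hypothesis `hA` of `Literature/Barriers/HodgeConjecture/KaehlerCounterexamplesJTorus.lean`
for `(Φ, A) = (skewPeriodCLE, squareMatrix)`. [cite: Zucker1977, Appendix B p. 207] -/
theorem skewPeriodCLE_mulVec (x : Fin 4 → ℝ) :
    skewPeriodCLE ((squareMatrix.map (Int.cast : ℤ → ℝ)).mulVec x) = J (skewPeriodCLE x) :=
  skewPeriod_mulVec x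

/-! ### Constant `2`-forms `f ∧ g` on a real normed space; `dz ∧ dw`, `dz ∧ dz̄`, `dw ∧ dw̄` on `ℂ²` -/

section Wedge

variable {E : Type*} [NormedAddCommGroup E] [NormedSpace ℂ E]

/-- The two permutations of `Fin 2`, as the universal finset. [folklore] -/
theorem univ_perm_fin_two :
    (Finset.univ : Finset (Equiv.Perm (Fin 2))) = {1, Equiv.swap 0 1} := by
  ext σ
  simp only [Finset.mem_univ, Finset.mem_insert, Finset.mem_singleton, true_iff]
  exact perm_fin_two σ

/-- **The wedge `f ∧ g`** of two continuous real-linear functionals with complex values: the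
continuous alternating `2`-form `(f ∧ g)(u, u') = f(u) g(u') - f(u') g(u)` (the alternation of
`f ⊗ g`). [folklore] -/
def wedgeForm (f g : E →L[ℝ] ℂ) : E [⋀^Fin 2]→L[ℝ] ℂ :=
  ContinuousMultilinearMap.alternatization
    ((ContinuousMultilinearMap.mkPiAlgebraFin ℝ 2 ℂ).compContinuousLinearMap fun i ↦ ![f, g] i)

/-- `(f ∧ g)(u, u') = f(u) g(u') - f(u') g(u)`. [folklore] -/
theorem wedgeForm_apply (f g : E →L[ℝ] ℂ) (v : Fin 2 → E) :
    wedgeForm f g v = f (v 0) * g (v 1) - f (v 1) * g (v 0) := by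
  simp only [wedgeForm, ContinuousMultilinearMap.alternatization_apply_apply, univ_perm_fin_two]
  rw [Finset.sum_pair (by decide)]
  simp [ContinuousMultilinearMap.mkPiAlgebraFin_apply, Equiv.Perm.sign_swap', Units.smul_def]
  ring

/-- `(f ∧ g)(u, u')` in `![u, u']` form. [folklore] -/
@[simp] theorem wedgeForm_apply_vecCons (f g : E →L[ℝ] ℂ) (u u' : E) :
    wedgeForm f g ![u, u'] = f u * g u' - f u' * g u :=
  wedgeForm_apply f g ![u, u']

end Wedge

/-- The real-linear coordinate functionals `dz_a : ℂ² → ℂ`, `u ↦ u_a` (`a = 0`: `dz`; `a = 1`: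
`dw`). [cite: Zucker1977, Appendix B p. 207] -/
def dz (a : Fin 2) : (Fin 2 → ℂ) →L[ℝ] ℂ :=
  (ContinuousLinearMap.proj (R := ℂ) (φ := fun _ : Fin 2 ↦ ℂ) a).restrictScalars ℝ

/-- `dz_a(u) = u_a`. [folklore] -/
@[simp] theorem dz_apply (a : Fin 2) (u : Fin 2 → ℂ) : dz a u = u a := rfl

/-- The conjugate coordinate functionals `dz̄_a : ℂ² → ℂ`, `u ↦ \overline{u_a}`.
[cite: Zucker1977, Appendix B p. 207] -/
def dzbar (a : Fin 2) : (Fin 2 → ℂ) →L[ℝ] ℂ :=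
  Complex.conjCLE.toContinuousLinearMap.comp (dz a)

/-- `dz̄_a(u) = \overline{u_a}`. [folklore] -/
@[simp] theorem dzbar_apply (a : Fin 2) (u : Fin 2 → ℂ) : dzbar a u = conj (u a) := rfl

/-- **`dz ∧ dw`**, the constant holomorphic `2`-form of `V = ℂ²` (Zucker p. 207: an integral
homology class dual to a class of type `(n, n)` "must annihilate … in particular, `dz ∧ dw`").
[cite: Zucker1977, Appendix B Proposition p. 207] -/
def dzdw : (Fin 2 → ℂ) [⋀^Fin 2]→L[ℝ] ℂ := wedgeForm (dz 0) (dz 1)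

/-- **`dz ∧ dz̄`** (so that `(i/2) dz ∧ dz̄` is the area form of the `z`-line). [folklore] -/
def dzdzbar : (Fin 2 → ℂ) [⋀^Fin 2]→L[ℝ] ℂ := wedgeForm (dz 0) (dzbar 0)

/-- **`dw ∧ dw̄`** (so that `(i/2) dw ∧ dw̄` is the area form of the `w`-line). [folklore] -/
def dwdwbar : (Fin 2 → ℂ) [⋀^Fin 2]→L[ℝ] ℂ := wedgeForm (dz 1) (dzbar 1)

/-- `(dz ∧ dw)(u, u') = z(u) w(u') - z(u') w(u)`. [folklore] -/
@[simp] theorem dzdw_apply (u u' : Fin 2 → ℂ) : dzdw ![u, u'] = u 0 * u' 1 - u' 0 * u 1 := by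
  simp [dzdw]

/-- `(dz ∧ dz̄)(u, u') = z(u) \overline{z(u')} - z(u') \overline{z(u)}`. [folklore] -/
@[simp] theorem dzdzbar_apply (u u' : Fin 2 → ℂ) :
    dzdzbar ![u, u'] = u 0 * conj (u' 0) - u' 0 * conj (u 0) := by
  simp [dzdzbar]

/-- `(dw ∧ dw̄)(u, u') = w(u) \overline{w(u')} - w(u') \overline{w(u)}`. [folklore] -/
@[simp] theorem dwdwbar_apply (u u' : Fin 2 → ℂ) :
    dwdwbar ![u, u'] = u 1 * conj (u' 1) - u' 1 * conj (u 1) := by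
  simp [dwdwbar]

/-! ### Integral bivectors of a lattice and their pairing with constant `2`-forms -/

section Pairing

variable {ι : Type*} [Fintype ι] [DecidableEq ι] {E : Type*} [NormedAddCommGroup E]
  [NormedSpace ℂ E]

/-- **Pairing of a constant `2`-form with an integral bivector.** For a period map
`Φ : ℝ^ι → E` (lattice `L = Φ(ℤ^ι)` with basis `e_j = Φ(δ_j)`), a continuous alternating `2`-form
`θ` on `E` with complex values and an integer matrix `n`, the number
`Σ_{j,k} n_{jk} θ(e_j, e_k)` — the "period" of `θ` over the integral `2`-homology class
`Σ_{j,k} n_{jk} e_j ∧ e_k ∈ ⋀² L = H₂(E/L; ℤ)` (Zucker p. 207: "the periods of `ω` over the real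
sub-tori `{e_I}` generated by any `2n` elements of the lattice basis, for these tori provide a
basis for the homology of `T`"). [cite: Zucker1977, Appendix B p. 207] -/
def latticePairing (Φ : (ι → ℝ) →ₗ[ℝ] E) (θ : E [⋀^Fin 2]→L[ℝ] ℂ) (n : ι → ι → ℤ) : ℂ :=
  ∑ j, ∑ k, (n j k : ℂ) * θ ![Φ (Pi.single j 1), Φ (Pi.single k 1)]

/-- Additivity of an alternating `2`-form over a finite sum in the first slot. [folklore] -/
theorem alt_sum₀ (c : E [⋀^Fin 2]→L[ℝ] ℂ) {α : Type*} (s : Finset α) (f : α → E) (y : E) :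
    c ![∑ i ∈ s, f i, y] = ∑ i ∈ s, c ![f i, y] := by
  induction s using Finset.cons_induction with
  | empty =>
    simp only [Finset.sum_empty]
    exact c.map_coord_zero 0 rfl
  | cons a s ha ih => rw [Finset.sum_cons, Finset.sum_cons, alt_add₀, ih]

/-- Additivity of an alternating `2`-form over a finite sum in the second slot. [folklore] -/
theorem alt_sum₁ (c : E [⋀^Fin 2]→L[ℝ] ℂ) {α : Type*} (s : Finset α) (x : E) (f : α → E) :
    c ![x, ∑ i ∈ s, f i] = ∑ i ∈ s, c ![x, f i] := by
  induction s using Finset.cons_induction with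
  | empty =>
    simp only [Finset.sum_empty]
    exact c.map_coord_zero 1 rfl
  | cons a s ha ih => rw [Finset.sum_cons, Finset.sum_cons, alt_add₁, ih]

/-- An integer vector as an integral combination of the coordinate vectors. [folklore] -/
theorem intCast_eq_sum_single (m : ι → ℤ) :
    (fun j ↦ (m j : ℝ)) = ∑ j, (m j : ℝ) • (Pi.single j (1 : ℝ) : ι → ℝ) := by
  funext i
  simp [Finset.sum_apply, Pi.single_apply]

/-- **Bilinear expansion**: the value of `θ` on two lattice vectors `Φ(m)`, `Φ(m')`
(`m, m' ∈ ℤ^ι`) is the pairing of `θ` with the decomposable integral bivector `m ∧ m'`,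
`n_{jk} = m_j m'_k`. [folklore] -/
theorem apply_intCast_eq_latticePairing (Φ : (ι → ℝ) →ₗ[ℝ] E)
    (θ : E [⋀^Fin 2]→L[ℝ] ℂ) (m m' : ι → ℤ) :
    θ ![Φ (fun j ↦ (m j : ℝ)), Φ (fun k ↦ (m' k : ℝ))] =
      latticePairing Φ θ (fun j k ↦ m j * m' k) := by
  rw [intCast_eq_sum_single m, intCast_eq_sum_single m', map_sum, map_sum, alt_sum₀]
  unfold latticePairing
  refine Finset.sum_congr rfl fun j _ ↦ ?_
  rw [map_smul, alt_smul₀, alt_sum₁, Finset.smul_sum]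
  refine Finset.sum_congr rfl fun k _ ↦ ?_
  rw [map_smul, alt_smul₁, Complex.real_smul, Complex.real_smul]
  push_cast
  ring

/-- **Expansion over `ι = Fin 4`**: the pairing only depends on the alternation
`n_{jk} - n_{kj}` and is the sum over the six pairs `j < k`. [folklore] -/
theorem latticePairing_fin_four (Φ : (Fin 4 → ℝ) →ₗ[ℝ] E) (θ : E [⋀^Fin 2]→L[ℝ] ℂ)
    (n : Fin 4 → Fin 4 → ℤ) :
    latticePairing Φ θ n =
      ((n 0 1 : ℂ) - n 1 0) * θ ![Φ (Pi.single 0 1), Φ (Pi.single 1 1)] +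
      ((n 0 2 : ℂ) - n 2 0) * θ ![Φ (Pi.single 0 1), Φ (Pi.single 2 1)] +
      ((n 0 3 : ℂ) - n 3 0) * θ ![Φ (Pi.single 0 1), Φ (Pi.single 3 1)] +
      ((n 1 2 : ℂ) - n 2 1) * θ ![Φ (Pi.single 1 1), Φ (Pi.single 2 1)] +
      ((n 1 3 : ℂ) - n 3 1) * θ ![Φ (Pi.single 1 1), Φ (Pi.single 3 1)] +
      ((n 2 3 : ℂ) - n 3 2) * θ ![Φ (Pi.single 2 1), Φ (Pi.single 3 1)] := by
  unfold latticePairing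
  simp only [Fin.sum_univ_four, alt_self, mul_zero, add_zero, zero_add]
  rw [alt_swap θ (Φ (Pi.single 1 1)) (Φ (Pi.single 0 1)),
    alt_swap θ (Φ (Pi.single 2 1)) (Φ (Pi.single 0 1)),
    alt_swap θ (Φ (Pi.single 3 1)) (Φ (Pi.single 0 1)),
    alt_swap θ (Φ (Pi.single 2 1)) (Φ (Pi.single 1 1)),
    alt_swap θ (Φ (Pi.single 3 1)) (Φ (Pi.single 1 1)),
    alt_swap θ (Φ (Pi.single 3 1)) (Φ (Pi.single 2 1))]
  ring

end Pairing

end Zucker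

end Literature.Geometry.Kaehler

end
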